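import Mathlib.Analysis.Polynomial.Norm
import Mathlib.Analysis.SpecialFunctions.Log.Base
import HarnessLib

/-!
# Iwasawa invariants `μ(θ)`, `λ(θ)` of an element of a finite layer `𝒪[G_n]` (Pollack–Weston §3.1)

R. Pollack, T. Weston, *Mazur–Tate elements of nonordinary modular forms*, Duke Math. J. **156**
(2011) 349–385 [PollackWeston2011MT] (held text `paper:arxiv-0906.1741`), §3.1 "Iwasawa invariants
in finite-level group algebras": for a finite integrally closed extension `𝒪` of `ℤ_p` and
`θ = ∑_{σ ∈ G_n} c_σ σ ∈ 𝒪[G_n]` (`G_n` cyclic of order `pⁿ`), "`μ(θ) = min_{σ ∈ G_n} ord_p(c_σ)`"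
(`ord_p(p) = 1`, "if `𝒪` is a ramified extension of `ℤ_p`, then `μ(L)` need not be in `ℤ`"), and
"`λ(θ) = ord_{I_n} θ̄' = max{j : θ̄' ∈ I_n^j}`" for `θ' = ϖ^{-a}θ` with `μ(θ') = 0`, `θ̄'` its image in
`𝔽[G_n]`, `I_n` the augmentation ideal.

The tree writes elements of `𝒪[G_n] = 𝒪[T]/((1+T)^{pⁿ} - 1)` as their canonical lifts of degree
`< pⁿ` in `T = γ - 1` (`mazurTateElement f p n ∈ ℚ[T]`, `mazurTateElementK g Ω p n ∈ K_g[T]`, read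
in `ℚ_p[T]` / `ℚ̄_p[T]` along an embedding). In the `T`-basis the two invariants are
`μ(θ) = -log_p max_j ‖a_j‖` and `λ(θ) = min{j : ‖a_j‖ = max_i ‖a_i‖}` for `θ = ∑_j a_j T^j`:
the change of basis `σ^s = (1+T)^s` (`0 ≤ s < pⁿ`) is unitriangular over `ℤ`, so the minimum
coefficient valuation is the same in both bases, and `𝔽[G_n] = 𝔽[T]/(T^{pⁿ})` with `I_n = (T)`, so
`ord_{I_n} θ̄'` is the least `j` whose coefficient of `θ'` is a unit, i.e. the least index at which
`max_i ‖a_i‖` is attained. This file gives these two DEFINITIONS for a polynomial over any normed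
ring `A` (through Mathlib's `Polynomial.supNorm = max_j ‖a_j‖`) with proved API; nothing is
asserted (PW Lemmas 3.1–3.3 and Thm. 4.1 are NOT vendored here). They apply verbatim to
`(mazurTateElement f p n).map (algebraMap ℚ ℚ_[p])` (the kit tables' `μ(θ_n)`, `λ(θ_n)` of a
rational elliptic curve) and to `(mazurTateElementK g Ω p n).map ι` (a newform with Hecke field
`K_g` along `ι : K_g → ℚ̄_p`, `Literature/NumberTheory/EllipticCurves/MazurTateElementCoeffField.lean`).
Topic `Literature/NumberTheory/IwasawaTheory` (namespace = path).

* `layerMu p θ = -log_p (supNorm θ)` (junk `0` at `θ = 0`, PW: `∞`); `layerMu_eq_zero_iff`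
  (`μ = 0 ⟺ max ‖a_j‖ = 1`), `layerMu_nonneg_iff` (`μ ≥ 0 ⟺` all `‖a_j‖ ≤ 1`),
  `norm_coeff_layerLambda_eq_rpow` (`‖a_{λ(θ)}‖ = p^{-μ(θ)}`).
* `layerLambda θ = min{j : ‖a_j‖ = supNorm θ}` (junk `0` at `θ = 0`); `norm_coeff_layerLambda`,
  `norm_coeff_lt_supNorm_of_lt_layerLambda`, `layerLambda_eq_iff`, `layerLambda_le_natDegree`.

## References

* R. Pollack, T. Weston, Duke Math. J. 156 (2011), §3.1. [PollackWeston2011MT]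
-/

noncomputable section

open Polynomial

namespace Literature.NumberTheory.IwasawaTheory

/-! ### Iwasawa invariants in the finite layers (Pollack–Weston §3.1) -/

section LayerInvariants

variable {A : Type*} [NormedRing A]

/-- **The `μ`-invariant of a finite-layer element** `θ = ∑_j a_j T^j` (Pollack–Weston 2011, §3.1:
"for `θ ∈ 𝒪[G_n]`, if write `θ = ∑_{σ ∈ G_n} c_σ σ`, we then define `μ(θ) = min_{σ ∈ G_n} ord_p(c_σ)`.
… Here we normalize `ord_p` so that `ord_p(p) = 1`. Note that under this normalization, if `𝒪` is a
ramified extension of `ℤ_p`, then `μ(L)` need not be in `ℤ`"): `μ(θ) = -log_p max_j ‖a_j‖`, the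
`p`-adic order of the largest coefficient (Mathlib's `Polynomial.supNorm`; for `A ⊆ ℚ̄_p`,
`‖x‖ = p^{-ord_p x}`). In the `T`-basis rather than PW's `σ`-basis: `σ^s = (1+T)^s` is a unimodular
change of basis over `ℤ`, so the minimum coefficient valuation is the same. Junk value `0` for
`θ = 0` (PW: `∞`). [cite: PollackWeston2011MT, §3.1 (definition of `μ(θ)`)] -/
def layerMu (p : ℕ) (θ : A[X]) : ℝ :=
  -Real.logb p θ.supNorm

/-- **The `λ`-invariant of a finite-layer element** `θ = ∑_j a_j T^j ≠ 0` (Pollack–Weston 2011, §3.1: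
"let `ϖ` be a uniformizer of `𝒪`, and set `θ' = ϖ^{-a} θ` with `a` chosen so that `μ(θ') = 0`. Let `𝔽`
be the residue field of `𝒪`, and let `θ̄'` denote the (non-zero) image of `θ'` under the natural map
`𝒪[G_n] → 𝔽[G_n]`. All ideals of `𝔽[G_n]` are of the form `I_n^j` with `I_n` the augmentation ideal;
we then define `λ(θ) = ord_{I_n} θ̄' = max{j : θ̄' ∈ I_n^j}`"): since `𝔽[G_n] = 𝔽[T]/(T^{pⁿ})` with
`I_n = (T)`, this is the least `j` whose coefficient survives in `θ̄'`, i.e. the least index at which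
the maximum `max_i ‖a_i‖` is attained — `min {j : ‖a_j‖ = supNorm θ}` (attained,
`Polynomial.exists_eq_supNorm`). Junk value `0` for `θ = 0`. [cite: PollackWeston2011MT, §3.1 (definition of `λ(θ)`)] -/
def layerLambda (θ : A[X]) : ℕ :=
  sInf {j : ℕ | ‖θ.coeff j‖ = θ.supNorm}

/-- Unfolding lemma for `layerMu`. [cite: PollackWeston2011MT, §3.1] -/
theorem layerMu_def (p : ℕ) (θ : A[X]) : layerMu p θ = -Real.logb p θ.supNorm :=
  rfl

/-- Unfolding lemma for `layerLambda`. [cite: PollackWeston2011MT, §3.1] -/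
theorem layerLambda_def (θ : A[X]) : layerLambda θ = sInf {j : ℕ | ‖θ.coeff j‖ = θ.supNorm} :=
  rfl

/-- The maximum coefficient norm is attained at the index `λ(θ)`. [cite: PollackWeston2011MT, §3.1] -/
theorem norm_coeff_layerLambda (θ : A[X]) : ‖θ.coeff (layerLambda θ)‖ = θ.supNorm := by
  have hne : {j : ℕ | ‖θ.coeff j‖ = θ.supNorm}.Nonempty := by
    obtain ⟨i, hi⟩ := θ.exists_eq_supNorm
    exact ⟨i, hi.symm⟩
  exact Nat.sInf_mem hne

/-- Before the index `λ(θ)` every coefficient is strictly smaller than the maximum (for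
`θ' = ϖ^{-a}θ`: reduces to `0` in `𝔽`, i.e. `θ̄' ∈ I_n^{λ}`). [cite: PollackWeston2011MT, §3.1] -/
theorem norm_coeff_lt_supNorm_of_lt_layerLambda {θ : A[X]} {j : ℕ} (hj : j < layerLambda θ) :
    ‖θ.coeff j‖ < θ.supNorm :=
  lt_of_le_of_ne (θ.le_supNorm j) fun h ↦ Nat.notMem_of_lt_sInf hj h

/-- `λ(θ)` is characterised by: the maximum norm is attained at `λ(θ)` and not before.
[cite: PollackWeston2011MT, §3.1] -/
theorem layerLambda_eq_iff {θ : A[X]} {m : ℕ} :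
    layerLambda θ = m ↔ ‖θ.coeff m‖ = θ.supNorm ∧ ∀ j < m, ‖θ.coeff j‖ < θ.supNorm := by
  constructor
  · rintro rfl
    exact ⟨norm_coeff_layerLambda θ, fun j hj ↦ norm_coeff_lt_supNorm_of_lt_layerLambda hj⟩
  · rintro ⟨hm, hlt⟩
    apply le_antisymm
    · exact Nat.sInf_le hm
    · by_contra hlt'
      exact (hlt _ (not_le.mp hlt')).ne (norm_coeff_layerLambda θ)

/-- For `θ ≠ 0` the index `λ(θ)` is at most the degree (the coefficient there is non-zero).
[cite: PollackWeston2011MT, §3.1] -/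
theorem layerLambda_le_natDegree {θ : A[X]} (hθ : θ ≠ 0) : layerLambda θ ≤ θ.natDegree := by
  refine le_natDegree_of_ne_zero fun h0 ↦ ?_
  have h := norm_coeff_layerLambda θ
  rw [h0, norm_zero] at h
  exact hθ ((supNorm_eq_zero_iff θ).mp h.symm)

/-- `λ(0) = 0` (junk value). [cite: PollackWeston2011MT, §3.1] -/
@[simp] theorem layerLambda_zero : layerLambda (0 : A[X]) = 0 := by
  rw [layerLambda, Nat.sInf_eq_zero]
  left
  simp

/-- `μ(0) = 0` (junk value; PW: `∞`). [cite: PollackWeston2011MT, §3.1] -/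
@[simp] theorem layerMu_zero (p : ℕ) : layerMu p (0 : A[X]) = 0 := by
  simp [layerMu]

/-- **`μ(θ) = 0` iff the largest coefficient is a unit** (`max_j ‖a_j‖ = 1`), for `θ ≠ 0` and `p > 1`.
[cite: PollackWeston2011MT, §3.1] -/
theorem layerMu_eq_zero_iff {p : ℕ} (hp : 1 < p) {θ : A[X]} (hθ : θ ≠ 0) :
    layerMu p θ = 0 ↔ θ.supNorm = 1 := by
  have hpos : 0 < θ.supNorm := lt_of_le_of_ne (supNorm_nonneg θ) (Ne.symm ((supNorm_eq_zero_iff θ).not.mpr hθ))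
  have hp' : (1 : ℝ) < p := by exact_mod_cast hp
  rw [layerMu, neg_eq_zero, Real.logb_eq_zero]
  constructor
  · rintro (h | h | h | h | h | h)
    · exact absurd h (by exact_mod_cast (zero_lt_one.trans hp).ne')
    · exact absurd h (by exact_mod_cast hp.ne')
    · linarith
    · exact absurd h hpos.ne'
    · exact h
    · linarith [supNorm_nonneg θ]
  · intro h
    exact Or.inr (Or.inr (Or.inr (Or.inr (Or.inl h))))

/-- **`μ(θ) ≥ 0` iff every coefficient is integral** (`max_j ‖a_j‖ ≤ 1`), for `θ ≠ 0` and `p > 1`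
(e.g. `θ = (θ_n(g)).map ι` for a cohomological period, `IsCohomologicalPlusPeriod.supNorm_map_mazurTateElementK_le_one`).
[cite: PollackWeston2011MT, §3.1 and Rem. 2.2] -/
theorem layerMu_nonneg_iff {p : ℕ} (hp : 1 < p) {θ : A[X]} (hθ : θ ≠ 0) :
    0 ≤ layerMu p θ ↔ θ.supNorm ≤ 1 := by
  have hpos : 0 < θ.supNorm := lt_of_le_of_ne (supNorm_nonneg θ) (Ne.symm ((supNorm_eq_zero_iff θ).not.mpr hθ))
  have hp' : (1 : ℝ) < p := by exact_mod_cast hp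
  rw [layerMu, neg_nonneg, Real.logb_nonpos_iff hp' hpos]

/-- `μ(θ) = ord_p` of the coefficient at `λ(θ)`: `‖a_{λ(θ)}‖ = p^{-μ(θ)}` (for `θ ≠ 0`, `p > 1`).
[cite: PollackWeston2011MT, §3.1] -/
theorem norm_coeff_layerLambda_eq_rpow {p : ℕ} (hp : 1 < p) {θ : A[X]} (hθ : θ ≠ 0) :
    ‖θ.coeff (layerLambda θ)‖ = (p : ℝ) ^ (-layerMu p θ) := by
  have hpos : 0 < θ.supNorm := lt_of_le_of_ne (supNorm_nonneg θ) (Ne.symm ((supNorm_eq_zero_iff θ).not.mpr hθ))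
  have hp' : (1 : ℝ) < p := by exact_mod_cast hp
  rw [norm_coeff_layerLambda, layerMu, neg_neg, Real.rpow_logb (zero_lt_one.trans hp') hp'.ne' hpos]

end LayerInvariants

end Literature.NumberTheory.IwasawaTheory

end
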